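import Summits.QuantumFields.BalabanUV.Beta.FP.TorusCompositeCovariance
import Summits.QuantumFields.BalabanUV.Beta.FP.PeriodisedBorderWardContact

/-!
# `BalabanUV.Beta.FP.TorusCompositeCovarianceOne` — road «FP» for binder row D1, ROUTE T, the OWNER d1-p3's SPEC-27 «THE (j, m) TORUS CALL FOR m ≥ 2»,
# **(COV-m) ORDER 1 AT EVERY DEPTH, PART 1 — THE COMPOSITE FIRST-ORDER INSERTION JET BY THE CHAIN RULE AND ITS GAUGE-COVARIANCE LAW ON ALL
# COLUMNS**: `compIns₁ … n h · D_finest = compRows … n · Tip(h) − Far_n(compRows … n · h)` (the `c1 ∕ d1` binders of the composite torus call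
# `FP/NestedStepLawTorusCompositeOneShot(Top)` (#19 ∕ #21) follow in PART 2 by reading this law through the tower generators)

WHY (R-D1-g42-4 (3), an2 g42, journal l.46750; an1 g78 W-2 l.46814).  The composite averaging's jets at depth `≥ 1` are NOT an1's one-shot tables at the
big blocking (the linearised two-stage transporters differ as tables); an1's records hold only the one-step (direct-contour) tables, so the composite
first-order table family is DEFINED BY THE RECURSION over the one-step tables — the chain rule of `C^{(n+1)} = C_top ∘ C^{(n)}`.  This file types that
recursion at the matrix level for the averaging (`Q`) class, order 1, and proves the ONE identity the torus call consumes: its gauge covariance.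

WHAT.  §1 ONE STEP `M ← fine Lc M` (root `r ∈ box`, level `ℓ`): [our object — bookkeeping] `stepIns₁ M Lc r w := Σ_b w b • perF (dper (vhSAt (toSite r) b))∘
((coarsePt, inr), (·, inl))` — (B)'s `hQ₁₁` shape, the rooted first-order border table of an1 inserted along a bond weight `w`; **`stepIns₁_mul_tgrad`**
(my g17 `PeriodisedBorderWardContact.submatrix_vhSAt_mul_tgrad`, ALL columns, weighted): `stepIns₁ w · D_fine = c_ℓ • (Qstep · Tip(w) − Far(Qstep·w))`,
`Tip(w)(b, s) = w b · [s ≡ b.1 + e_{b.2}]`, `Far(v)(a, s) = v a · [s = rootPt (a.1 + e_{a.2})]` (the TIP contact and the FAR-ROOT contact),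
`c_ℓ = (Lc^{d+1}·stepScale d Lc ℓ)⁻¹`.  §2 THE TOWER (leaf-06 `TorusCompositeObjects`, my g21 `TorusCompositeCovariance`, BY NAME): [our object —
bookkeeping] **`compIns₁ Lc M lev rs n h`** — `0` at depth `0`; at depth `n+1`: `θ_n • stepIns₁ M Lc (rs 1) (compRows^{low} · h) · compRows^{low} + Qstep ·
compIns₁^{low} h` with `θ_n = Lc^{d+1}·stepScale d Lc (lev 1) ∕ σ_n^{low}` (the chain rule: the top step's jet along the TRANSPORTED direction, plus the top
step's rows on the lower jet; `θ_n` is forced by covariance); `compRows_mul_tgrad` (the COMPOSITE MASTER identity on all columns: `compRows · D_finest =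
σ_n • D_M · [s = itRoot u]`), `of_tdelta_mul` (contact matrices compose through `wrapPt`), and **`compIns₁_mul_tgrad`** (induction; step
`compIns₁_mul_tgrad_step`): `compIns₁ n h · D_finest = compRows n · Tip(h) − Far_n(compRows n · h)`, `Far_n(v)(a, s) = v a · [s = itRoot n (a.1 + e_{a.2})]`.
[our object] two bookkeeping defs + [folklore] finite sums BY NAME; no `def … : Prop`, nothing cited, 0 sorry.  Nothing of the dictionary ∕ Bałaban's
asserted (that Bałaban's `m`-fold averaging IS the composition whose jet this is, is an2's (C1) TABLE word, R-D1-g42-4).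

HONEST DEPENDENCY (page 1, mandatory): continuum YM on T⁴ ⇐ BetaPertH ∧ nine spine estimates (0/9 proved); BetaPertH ⇐ (D1) ∧ (D4) ∧ CAP+tail;
G-an2-4 gates asym, D1 and NE2/3/4.  HONEST FRAMING (cell contract, verbatim): «discharging `BetaPertH` makes Bałaban's UV stability UNCONDITIONAL —
a real constructive-QFT result; it is NOT the continuum limit and NOT the Clay problem.»  ABSOLUTE RULE (cell charter, verbatim): «No internally-minted
statement may enter as a cited fact. Every hypothesis is either kernel-proved in this package or a verbatim quotation of a PUBLISHED theorem with page
reference. The manuscript(s) under audit are NOT citable for their own disputed steps — they are the thing under adjudication; programme-internal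
(2001/route/tribunal) claims are never citable.»  0 estimates; 0∕4 row-D1 binders; NOT (T-ID), NOT SDF, NOT D1, NOT BetaPertH, NOT continuum, NOT Clay.
D1 formalisation swarm LEAF PROVER 02 (b2b-balaban-beta-d1-formalise-leaf-02 gen 22), 2026-08-22.  No existing file touched.
-/

noncomputable section

open scoped BigOperators

namespace Summit.QuantumFields.BalabanUV.Beta.FP.TorusCompositeCovarianceOne

open Matrix Finset
open Literature.MathematicalPhysics.QuantumFieldTheory
open Literature.MathematicalPhysics.QuantumFieldTheory.Balaban1983to89
open Literature.MathematicalPhysics.QuantumFieldTheory.Balaban1983to89.Beta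
open B5Prop11Plancherel (fine)
open B6Lemma24Torus (pbox mem_pbox)
open AffineAveraging (Site box toSite unitVec)
open AveragingHessianKernelsRooted (vhSAt)
open OneStepResolventKernel (Fib)
open Summit.QuantumFields.BalabanUV.Beta.BorderedHessian (bhKStepAt stepScale stepScale_ne_zero)
open Summit.QuantumFields.BalabanUV.Beta.FP.KernelPeriodisationFib (Idx perF)
open Summit.QuantumFields.BalabanUV.Beta.FP.KernelPeriodisationFibLoc (dper)
open Summit.QuantumFields.BalabanUV.Beta.FP.TorusGaugeCovariance (tdelta tgrad)
open Summit.QuantumFields.BalabanUV.Beta.FP.TorusGaugeCovariancePairing (wrapPt wrapPt_of_mem tdelta_eq_ite_wrapPt sum_tdelta_mul)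
open Summit.QuantumFields.BalabanUV.Beta.FP.TorusGaugeCovarianceCoarse (coarsePt)
open Summit.QuantumFields.BalabanUV.Beta.FP.PeriodisedBorderWardContact (submatrix_vhSAt_mul_tgrad)
open Summit.QuantumFields.BalabanUV.Beta.FP.TorusCompositeObjects
open Summit.QuantumFields.BalabanUV.Beta.FP.TorusCompositeCovariance (rootPt wrapPt_coarsePt_add_add itRoot itRoot_zero itRoot_succ compRows_mul_tgrad_mul)

variable {d : ℕ}

/-! ## §1 One step: the rooted first-order insertion jet along a bond weight, and its covariance law on ALL gauge columns -/

section OneStep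

variable (M : Fin (d + 1) → ℕ) [∀ μ, NeZero (M μ)] (Lc : ℕ) [NeZero Lc] {r : Fin (d + 1) → ℕ}

omit [∀ μ, NeZero (M μ)] in
/-- [folklore] the periodic indicator does not see the choice of representative: `tdelta A (wrapPt A x) s = tdelta A x s`. -/
theorem tdelta_wrapPt (A : Fin (d + 1) → ℕ) [∀ μ, NeZero (A μ)] (x : Site (d + 1)) (s : ↥(pbox A)) :
    tdelta A ((wrapPt A x : ↥(pbox A)) : Site (d + 1)) s = tdelta A x s := by
  rw [tdelta_eq_ite_wrapPt, tdelta_eq_ite_wrapPt, wrapPt_of_mem]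

omit [∀ μ, NeZero (M μ)] in
/-- [folklore] **CONTACT MATRICES COMPOSE THROUGH THE REPRESENTATIVE**: `(v a · [· ≡ x a]) · F = v a · F (wrapPt (x a))` (`sum_tdelta_mul`). -/
theorem of_tdelta_mul (A : Fin (d + 1) → ℕ) [∀ μ, NeZero (A μ)] {ι Y : Type*} (v : ι → ℝ) (x : ι → Site (d + 1)) (F : Matrix ↥(pbox A) Y ℝ) :
    Matrix.of (fun (a : ι) (t : ↥(pbox A)) => v a * tdelta A (x a) t) * F = Matrix.of (fun (a : ι) (y : Y) => v a * F (wrapPt A (x a)) y) := by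
  ext a y
  simp only [Matrix.mul_apply, Matrix.of_apply, mul_assoc, ← Finset.mul_sum, sum_tdelta_mul]

/-- [our object — bookkeeping] **THE ONE-STEP FIRST-ORDER INSERTION JET ALONG A BOND WEIGHT `w`** of the rooted averaging `M ← fine Lc M` (root `toSite r`):
`Σ_b w b •` an1's rooted first-order border table `vhSAt (toSite r) b.2 b.1`, periodised on the fine torus, read on ((coarse multiplier slots at `coarsePt`,
`inr`), (fine field slots, `inl`)) — EXACTLY (B)'s `hQ₁₁` shape (`NestedStepLawTorusTransportedRowsGraded`), level-free. -/
def stepIns₁ (r : Fin (d + 1) → ℕ) (w : ↥(pbox (fine Lc M)) × Fin (d + 1) → ℝ) :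
    Matrix (↥(pbox M) × Fin (d + 1)) (↥(pbox (fine Lc M)) × Fin (d + 1)) ℝ :=
  ∑ b : ↥(pbox (fine Lc M)) × Fin (d + 1), w b •
    (perF (fine Lc M) (dper (fine Lc M) (vhSAt (toSite r) d Lc rfl b.2 (b.1 : Site (d + 1))))).submatrix
      (fun a : ↥(pbox M) × Fin (d + 1) => ((coarsePt M Lc a.1, Sum.inr a.2) : Idx (fine Lc M) (Fib d)))
      (fun b : ↥(pbox (fine Lc M)) × Fin (d + 1) => ((b.1, Sum.inl b.2) : Idx (fine Lc M) (Fib d)))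

/-- [folklore] **`stepIns₁_mul_tgrad` — THE ONE-STEP COVARIANCE LAW ON ALL GAUGE COLUMNS** (my g17 `submatrix_vhSAt_mul_tgrad`, weighted; `r ∈ box`, ANY
level `ℓ` on the right — `c_ℓ • Qstep_ℓ` is level-free): `stepIns₁ w · D_fine = c_ℓ • (Qstep · Tip(w) − Far(Qstep · w))` — the TIP contact `Tip(w)(b, s) =
w b · [s ≡ b.1 + e_{b.2}]` and the FAR-ROOT contact `Far(v)(a, s) = v a · [s = rootPt (a.1 + e_{a.2})]` (the root site of the far block of the coarse bond `a`,
my g21 `wrapPt_coarsePt_add_add`), `c_ℓ = (Lc^{d+1}·stepScale d Lc ℓ)⁻¹`. -/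
theorem stepIns₁_mul_tgrad (hr : r ∈ box (d + 1) Lc) (ℓ : ℕ) (w : ↥(pbox (fine Lc M)) × Fin (d + 1) → ℝ) :
    stepIns₁ M Lc r w * (tgrad (fine Lc M)).submatrix (fun b : ↥(pbox (fine Lc M)) × Fin (d + 1) => ((b.1, Sum.inl b.2) : Idx (fine Lc M) (Fib d))) id
      = ((Lc : ℝ) ^ (d + 1) * stepScale d Lc ℓ)⁻¹ •
          (Qstep Lc M ℓ r * Matrix.of (fun (b : ↥(pbox (fine Lc M)) × Fin (d + 1)) (s : ↥(pbox (fine Lc M))) =>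
              w b * tdelta (fine Lc M) ((b.1 : Site (d + 1)) + unitVec b.2) s)
            - Matrix.of (fun (a : ↥(pbox M) × Fin (d + 1)) (s : ↥(pbox (fine Lc M))) =>
                (Qstep Lc M ℓ r *ᵥ w) a
                  * tdelta (fine Lc M) ((rootPt M Lc hr (wrapPt M ((a.1 : Site (d + 1)) + unitVec a.2)) : ↥(pbox (fine Lc M))) : Site (d + 1)) s)) := by
  ext a s
  have key : ∀ b : ↥(pbox (fine Lc M)) × Fin (d + 1),
      ((perF (fine Lc M) (dper (fine Lc M) (vhSAt (toSite r) d Lc rfl b.2 (b.1 : Site (d + 1))))).submatrix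
            (fun a : ↥(pbox M) × Fin (d + 1) => ((coarsePt M Lc a.1, Sum.inr a.2) : Idx (fine Lc M) (Fib d)))
            (fun b : ↥(pbox (fine Lc M)) × Fin (d + 1) => ((b.1, Sum.inl b.2) : Idx (fine Lc M) (Fib d)))
          * (tgrad (fine Lc M)).submatrix (fun b : ↥(pbox (fine Lc M)) × Fin (d + 1) => ((b.1, Sum.inl b.2) : Idx (fine Lc M) (Fib d))) id) a s
        = (tdelta (fine Lc M) ((b.1 : Site (d + 1)) + unitVec b.2) s
            - tdelta (fine Lc M) ((rootPt M Lc hr (wrapPt M ((a.1 : Site (d + 1)) + unitVec a.2)) : ↥(pbox (fine Lc M))) : Site (d + 1)) s)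
          * ((((Lc : ℝ) ^ (d + 1) * stepScale d Lc ℓ)⁻¹) * Qstep Lc M ℓ r a b) := fun b => by
    rw [submatrix_vhSAt_mul_tgrad (M := fine Lc M) (M' := M) (fun i => rfl) hr ℓ (fun a : ↥(pbox M) × Fin (d + 1) => (coarsePt M Lc a.1 : Site (d + 1)))
      (fun a => (coarsePt M Lc a.1).2) (fun a : ↥(pbox M) × Fin (d + 1) => a.2) id b.2 b.1 a s,
      ← tdelta_wrapPt (fine Lc M) ((coarsePt M Lc a.1 : Site (d + 1)) + toSite r + (Lc : ℤ) • unitVec a.2), wrapPt_coarsePt_add_add M Lc hr]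
    rfl
  rw [stepIns₁, Matrix.sum_mul, Matrix.sum_apply]
  simp only [Matrix.smul_mul, Matrix.smul_apply, smul_eq_mul, key]
  simp only [Matrix.sub_apply, Matrix.mul_apply, Matrix.of_apply, Matrix.mulVec, dotProduct, Finset.sum_mul, mul_sub, Finset.mul_sum]
  rw [← Finset.sum_sub_distrib]
  exact Finset.sum_congr rfl fun b _ => by ring

end OneStep

/-! ## §2 The tower: the composite first-order insertion jet by the chain rule; its covariance law on all columns -/

section Tower

variable (Lc : ℕ) [NeZero Lc]

/-- [our object — bookkeeping] **THE COMPOSITE FIRST-ORDER INSERTION JET OF THE `n`-FOLD AVERAGING `compRows Lc M lev rs n` ALONG A BOND WEIGHT `h` ON THE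
FINEST TORUS, BY THE CHAIN RULE** (push-inside recursion as `compRows`; `lev ∕ rs` indexed from the top, the step `M ← fine Lc M` at level `lev 1` with root
`rs 1`): `0` at depth `0` (the identity map has no second jet); at depth `n+1`: the top step's jet `stepIns₁` along the TRANSPORTED direction
`compRows^{low} · h` (the lower composite's image of `h`), weighted by `θ_n = Lc^{d+1}·stepScale d Lc (lev 1) ∕ σ_n^{low}` (`σ_n^{low} = ∏_{i<n} stepScale d
Lc (lev (i+2))·#B`, the lower composite's normalisation — `θ_n` is FORCED by covariance, `compIns₁_mul_tgrad`), composed with the lower composite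
averaging, PLUS the top step's averaging rows composed with the lower composite's own jet. -/
def compIns₁ : (M : Fin (d + 1) → ℕ) → [∀ μ, NeZero (M μ)] → (lev : ℕ → ℕ) → (rs : ℕ → (Fin (d + 1) → ℕ)) → (n : ℕ) →
    ((↥(pbox (towerTorus Lc M n)) × Fin (d + 1) → ℝ)) → Matrix (↥(pbox M) × Fin (d + 1)) (↥(pbox (towerTorus Lc M n)) × Fin (d + 1)) ℝ
  | _, _, _, _, 0, _ => 0
  | M, _, lev, rs, n + 1, h =>
    (((Lc : ℝ) ^ (d + 1) * stepScale d Lc (lev 1)) * (∏ i ∈ range n, (stepScale d Lc (lev (i + 1 + 1)) * ((box (d + 1) Lc).card : ℝ)))⁻¹) •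
        (stepIns₁ M Lc (rs 1) ((compRows Lc (fine Lc M) (fun k => lev (k + 1)) (fun k => rs (k + 1)) n) *ᵥ h)
          * compRows Lc (fine Lc M) (fun k => lev (k + 1)) (fun k => rs (k + 1)) n)
      + Qstep Lc M (lev 1) (rs 1) * compIns₁ (fine Lc M) (fun k => lev (k + 1)) (fun k => rs (k + 1)) n h

/-- unfolding, depth `0`. -/
@[simp] theorem compIns₁_zero (M : Fin (d + 1) → ℕ) [∀ μ, NeZero (M μ)] (lev : ℕ → ℕ) (rs : ℕ → (Fin (d + 1) → ℕ)) (h : ↥(pbox M) × Fin (d + 1) → ℝ) :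
    compIns₁ Lc M lev rs 0 h = 0 := rfl

/-- unfolding, depth `n+1` — TOP-PEEL BY `rfl` (the chain rule). -/
theorem compIns₁_succ (M : Fin (d + 1) → ℕ) [∀ μ, NeZero (M μ)] (lev : ℕ → ℕ) (rs : ℕ → (Fin (d + 1) → ℕ)) (n : ℕ)
    (h : ↥(pbox (towerTorus Lc (fine Lc M) n)) × Fin (d + 1) → ℝ) :
    compIns₁ Lc M lev rs (n + 1) h
      = (((Lc : ℝ) ^ (d + 1) * stepScale d Lc (lev 1)) * (∏ i ∈ range n, (stepScale d Lc (lev (i + 1 + 1)) * ((box (d + 1) Lc).card : ℝ)))⁻¹) •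
          (stepIns₁ M Lc (rs 1) ((compRows Lc (fine Lc M) (fun k => lev (k + 1)) (fun k => rs (k + 1)) n) *ᵥ h)
            * compRows Lc (fine Lc M) (fun k => lev (k + 1)) (fun k => rs (k + 1)) n)
        + Qstep Lc M (lev 1) (rs 1) * compIns₁ Lc (fine Lc M) (fun k => lev (k + 1)) (fun k => rs (k + 1)) n h := rfl

/-- the one-fold composite jet is the one-step jet with `θ_0 = c_{lev 1}⁻¹`: `compIns₁ … 1 h = (Lc^{d+1}·stepScale d Lc (lev 1)) • stepIns₁ M Lc (rs 1) h`. -/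
theorem compIns₁_one (M : Fin (d + 1) → ℕ) [∀ μ, NeZero (M μ)] (lev : ℕ → ℕ) (rs : ℕ → (Fin (d + 1) → ℕ)) (h : ↥(pbox (fine Lc M)) × Fin (d + 1) → ℝ) :
    compIns₁ Lc M lev rs 1 h = ((Lc : ℝ) ^ (d + 1) * stepScale d Lc (lev 1)) • stepIns₁ M Lc (rs 1) h := by
  show (((Lc : ℝ) ^ (d + 1) * stepScale d Lc (lev 1)) * (∏ i ∈ range 0, (stepScale d Lc (lev (i + 1 + 1)) * ((box (d + 1) Lc).card : ℝ)))⁻¹) •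
        (stepIns₁ M Lc (rs 1) ((1 : Matrix (↥(pbox (fine Lc M)) × Fin (d + 1)) (↥(pbox (fine Lc M)) × Fin (d + 1)) ℝ) *ᵥ h)
          * (1 : Matrix (↥(pbox (fine Lc M)) × Fin (d + 1)) (↥(pbox (fine Lc M)) × Fin (d + 1)) ℝ))
      + Qstep Lc M (lev 1) (rs 1) * (0 : Matrix (↥(pbox (fine Lc M)) × Fin (d + 1)) (↥(pbox (fine Lc M)) × Fin (d + 1)) ℝ) = _
  rw [Matrix.mul_one, Matrix.one_mulVec, Matrix.mul_zero, add_zero, prod_range_zero, inv_one, mul_one]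

/-- [folklore] **THE COMPOSITE MASTER IDENTITY ON ALL COLUMNS** (my g21 `compRows_mul_tgrad_mul` at `C := 1`): `compRows … n · D_finest = σ_n • D_M · [s =
itRoot n u]`, `σ_n = ∏_{i<n} stepScale d Lc (lev (i+1))·#B`. -/
theorem compRows_mul_tgrad (n : ℕ) (M : Fin (d + 1) → ℕ) [∀ μ, NeZero (M μ)] (lev : ℕ → ℕ) (rs : ℕ → (Fin (d + 1) → ℕ)) (hrs : ∀ k, rs k ∈ box (d + 1) Lc) :
    compRows Lc M lev rs n
        * (tgrad (towerTorus Lc M n)).submatrix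
            (fun b : ↥(pbox (towerTorus Lc M n)) × Fin (d + 1) => ((b.1, Sum.inl b.2) : Idx (towerTorus Lc M n) (Fib d))) id
      = (∏ i ∈ range n, (stepScale d Lc (lev (i + 1)) * ((box (d + 1) Lc).card : ℝ))) •
          ((tgrad M).submatrix (fun a : ↥(pbox M) × Fin (d + 1) => ((a.1, Sum.inl a.2) : Idx M (Fib d))) id
            * Matrix.of (fun (u : ↥(pbox M)) (s : ↥(pbox (towerTorus Lc M n))) =>
                tdelta (towerTorus Lc M n) ((itRoot Lc M rs hrs n u : ↥(pbox (towerTorus Lc M n))) : Site (d + 1)) s)) := by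
  have h1 := compRows_mul_tgrad_mul Lc n M lev rs hrs (1 : Matrix ↥(pbox (towerTorus Lc M n)) ↥(pbox (towerTorus Lc M n)) ℝ)
  rw [Matrix.mul_one] at h1
  rw [h1]
  congr 2
  ext u s
  simp only [Matrix.submatrix_apply, Matrix.of_apply, id, Matrix.one_apply, tdelta_eq_ite_wrapPt, wrapPt_of_mem]
  by_cases hu : itRoot Lc M rs hrs n u = s <;> simp [hu]

/-- [folklore] the composite normalisation `σ_n ≠ 0` (`stepScale ≠ 0`, the box is non-empty). -/
theorem prod_stepScale_mul_card_ne_zero' (hLc : (box (d + 1) Lc).Nonempty) (f : ℕ → ℕ) (m : ℕ) :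
    (∏ i ∈ range m, (stepScale d Lc (f i) * ((box (d + 1) Lc).card : ℝ))) ≠ 0 :=
  prod_ne_zero_iff.mpr fun i _ => mul_ne_zero (stepScale_ne_zero _) (by exact_mod_cast (Finset.card_pos.mpr hLc).ne')

/-- [folklore] **(COV-m) ORDER 1, THE INDUCTION STEP** (top peel; stated in the tower's push-inside types — `compIns₁ … (n+1)`, `compRows … (n+1)`, `itRoot …
(n+1)` UNFOLDED by `rfl`): the chain rule's two summands against the finest gradient — the top step's jet along the transported direction meets the
COMPOSITE MASTER identity (`compRows_mul_tgrad`) and then the ONE-STEP law (`stepIns₁_mul_tgrad`), whose tip contact CANCELS the lower law's far-root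
contact (this is what fixes `θ_n`) and whose far-root contact is the new one; the top rows carry the lower law's tip term to the composite tip term. -/
theorem compIns₁_mul_tgrad_step (n : ℕ) (M : Fin (d + 1) → ℕ) [∀ μ, NeZero (M μ)] (lev : ℕ → ℕ) (rs : ℕ → (Fin (d + 1) → ℕ))
    (hrs : ∀ k, rs k ∈ box (d + 1) Lc) (h : ↥(pbox (towerTorus Lc (fine Lc M) n)) × Fin (d + 1) → ℝ)
    (ih : compIns₁ Lc (fine Lc M) (fun k => lev (k + 1)) (fun k => rs (k + 1)) n h
        * (tgrad (towerTorus Lc (fine Lc M) n)).submatrix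
            (fun b : ↥(pbox (towerTorus Lc (fine Lc M) n)) × Fin (d + 1) => ((b.1, Sum.inl b.2) : Idx (towerTorus Lc (fine Lc M) n) (Fib d))) id
      = compRows Lc (fine Lc M) (fun k => lev (k + 1)) (fun k => rs (k + 1)) n
            * Matrix.of (fun (b : ↥(pbox (towerTorus Lc (fine Lc M) n)) × Fin (d + 1)) (s : ↥(pbox (towerTorus Lc (fine Lc M) n))) =>
                h b * tdelta (towerTorus Lc (fine Lc M) n) ((b.1 : Site (d + 1)) + unitVec b.2) s)
          - Matrix.of (fun (a : ↥(pbox (fine Lc M)) × Fin (d + 1)) (s : ↥(pbox (towerTorus Lc (fine Lc M) n))) =>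
              (compRows Lc (fine Lc M) (fun k => lev (k + 1)) (fun k => rs (k + 1)) n *ᵥ h) a
                * tdelta (towerTorus Lc (fine Lc M) n)
                    ((itRoot Lc (fine Lc M) (fun k => rs (k + 1)) (fun k => hrs (k + 1)) n
                        (wrapPt (fine Lc M) ((a.1 : Site (d + 1)) + unitVec a.2)) : ↥(pbox (towerTorus Lc (fine Lc M) n))) : Site (d + 1)) s)) :
    ((((Lc : ℝ) ^ (d + 1) * stepScale d Lc (lev 1)) * (∏ i ∈ range n, (stepScale d Lc (lev (i + 1 + 1)) * ((box (d + 1) Lc).card : ℝ)))⁻¹) •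
          (stepIns₁ M Lc (rs 1) ((compRows Lc (fine Lc M) (fun k => lev (k + 1)) (fun k => rs (k + 1)) n) *ᵥ h)
            * compRows Lc (fine Lc M) (fun k => lev (k + 1)) (fun k => rs (k + 1)) n)
        + Qstep Lc M (lev 1) (rs 1) * compIns₁ Lc (fine Lc M) (fun k => lev (k + 1)) (fun k => rs (k + 1)) n h)
        * (tgrad (towerTorus Lc (fine Lc M) n)).submatrix
            (fun b : ↥(pbox (towerTorus Lc (fine Lc M) n)) × Fin (d + 1) => ((b.1, Sum.inl b.2) : Idx (towerTorus Lc (fine Lc M) n) (Fib d))) id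
      = Qstep Lc M (lev 1) (rs 1) * compRows Lc (fine Lc M) (fun k => lev (k + 1)) (fun k => rs (k + 1)) n
            * Matrix.of (fun (b : ↥(pbox (towerTorus Lc (fine Lc M) n)) × Fin (d + 1)) (s : ↥(pbox (towerTorus Lc (fine Lc M) n))) =>
                h b * tdelta (towerTorus Lc (fine Lc M) n) ((b.1 : Site (d + 1)) + unitVec b.2) s)
          - Matrix.of (fun (a : ↥(pbox M) × Fin (d + 1)) (s : ↥(pbox (towerTorus Lc (fine Lc M) n))) =>
              ((Qstep Lc M (lev 1) (rs 1) * compRows Lc (fine Lc M) (fun k => lev (k + 1)) (fun k => rs (k + 1)) n) *ᵥ h) a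
                * tdelta (towerTorus Lc (fine Lc M) n)
                    ((itRoot Lc (fine Lc M) (fun k => rs (k + 1)) (fun k => hrs (k + 1)) n
                        (rootPt M Lc (hrs 1) (wrapPt M ((a.1 : Site (d + 1)) + unitVec a.2))) : ↥(pbox (towerTorus Lc (fine Lc M) n))) : Site (d + 1)) s) := by
  have hB : (box (d + 1) Lc).Nonempty := ⟨rs 0, hrs 0⟩
  have hθ : ((Lc : ℝ) ^ (d + 1) * stepScale d Lc (lev 1)) * (∏ i ∈ range n, (stepScale d Lc (lev (i + 1 + 1)) * ((box (d + 1) Lc).card : ℝ)))⁻¹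
      * (∏ i ∈ range n, (stepScale d Lc (lev (i + 1 + 1)) * ((box (d + 1) Lc).card : ℝ))) * ((Lc : ℝ) ^ (d + 1) * stepScale d Lc (lev 1))⁻¹ = 1 := by
    rw [inv_mul_cancel_right₀ (prod_stepScale_mul_card_ne_zero' Lc hB (fun i => lev (i + 1 + 1)) n),
      mul_inv_cancel₀ (mul_ne_zero (pow_ne_zero _ (by exact_mod_cast NeZero.ne Lc)) (stepScale_ne_zero _))]
  -- the two contact compositions through the lower tower's iterated-root indicator (`of_tdelta_mul`)
  have tipR : Qstep Lc M (lev 1) (rs 1)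
        * Matrix.of (fun (b : ↥(pbox (fine Lc M)) × Fin (d + 1)) (t : ↥(pbox (fine Lc M))) =>
            (compRows Lc (fine Lc M) (fun k => lev (k + 1)) (fun k => rs (k + 1)) n *ᵥ h) b * tdelta (fine Lc M) ((b.1 : Site (d + 1)) + unitVec b.2) t)
        * Matrix.of (fun (u : ↥(pbox (fine Lc M))) (s : ↥(pbox (towerTorus Lc (fine Lc M) n))) =>
            tdelta (towerTorus Lc (fine Lc M) n)
              ((itRoot Lc (fine Lc M) (fun k => rs (k + 1)) (fun k => hrs (k + 1)) n u : ↥(pbox (towerTorus Lc (fine Lc M) n))) : Site (d + 1)) s)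
      = Qstep Lc M (lev 1) (rs 1)
          * Matrix.of (fun (a : ↥(pbox (fine Lc M)) × Fin (d + 1)) (s : ↥(pbox (towerTorus Lc (fine Lc M) n))) =>
              (compRows Lc (fine Lc M) (fun k => lev (k + 1)) (fun k => rs (k + 1)) n *ᵥ h) a
                * tdelta (towerTorus Lc (fine Lc M) n)
                    ((itRoot Lc (fine Lc M) (fun k => rs (k + 1)) (fun k => hrs (k + 1)) n
                        (wrapPt (fine Lc M) ((a.1 : Site (d + 1)) + unitVec a.2)) : ↥(pbox (towerTorus Lc (fine Lc M) n))) : Site (d + 1)) s) := by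
    rw [Matrix.mul_assoc, of_tdelta_mul (fine Lc M)]
    congr 1
  have farR : Matrix.of (fun (a : ↥(pbox M) × Fin (d + 1)) (t : ↥(pbox (fine Lc M))) =>
        (Qstep Lc M (lev 1) (rs 1) *ᵥ (compRows Lc (fine Lc M) (fun k => lev (k + 1)) (fun k => rs (k + 1)) n *ᵥ h)) a
          * tdelta (fine Lc M) ((rootPt M Lc (hrs 1) (wrapPt M ((a.1 : Site (d + 1)) + unitVec a.2)) : ↥(pbox (fine Lc M))) : Site (d + 1)) t)
        * Matrix.of (fun (u : ↥(pbox (fine Lc M))) (s : ↥(pbox (towerTorus Lc (fine Lc M) n))) =>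
            tdelta (towerTorus Lc (fine Lc M) n)
              ((itRoot Lc (fine Lc M) (fun k => rs (k + 1)) (fun k => hrs (k + 1)) n u : ↥(pbox (towerTorus Lc (fine Lc M) n))) : Site (d + 1)) s)
      = Matrix.of (fun (a : ↥(pbox M) × Fin (d + 1)) (s : ↥(pbox (towerTorus Lc (fine Lc M) n))) =>
          ((Qstep Lc M (lev 1) (rs 1) * compRows Lc (fine Lc M) (fun k => lev (k + 1)) (fun k => rs (k + 1)) n) *ᵥ h) a
            * tdelta (towerTorus Lc (fine Lc M) n)
                ((itRoot Lc (fine Lc M) (fun k => rs (k + 1)) (fun k => hrs (k + 1)) n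
                    (rootPt M Lc (hrs 1) (wrapPt M ((a.1 : Site (d + 1)) + unitVec a.2))) : ↥(pbox (towerTorus Lc (fine Lc M) n))) : Site (d + 1)) s) := by
    rw [of_tdelta_mul (fine Lc M)]
    ext a s
    simp only [Matrix.of_apply, wrapPt_of_mem, Matrix.mulVec_mulVec]
  rw [Matrix.add_mul, Matrix.smul_mul, Matrix.mul_assoc, Matrix.mul_assoc, compRows_mul_tgrad Lc n (fine Lc M) _ _ (fun k => hrs (k + 1)), ih,
    Matrix.mul_smul, ← Matrix.mul_assoc, stepIns₁_mul_tgrad M Lc (hrs 1) (lev 1), Matrix.smul_mul, Matrix.sub_mul, tipR, farR,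
    smul_smul, smul_smul, hθ, one_smul, Matrix.mul_sub, ← Matrix.mul_assoc]
  abel

/-- [folklore] **`compIns₁_mul_tgrad` — (COV-m) ORDER 1: THE COMPOSITE FIRST-ORDER INSERTION JET's GAUGE-COVARIANCE LAW ON ALL COLUMNS, AT EVERY DEPTH**:
`compIns₁ … n h · D_finest = compRows … n · Tip(h) − Far_n(compRows … n · h)` — `Tip(h)(b, s) = h b · [s ≡ b.1 + e_{b.2}]` (the tip contact on the finest torus),
`Far_n(v)(a, s) = v a · [s = itRoot n (a.1 + e_{a.2})]` (the contact at the ITERATED ROOT of the far endpoint of the top bond `a`).  Depth `0`: both sides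
vanish; the step is `compIns₁_mul_tgrad_step` (its unfolded shapes are this statement at depth `n+1` by `rfl`).  PART 2 reads this through the tower
generators (`towerGen = D_finest · evalN`): the tip term is `−Q₁₀·W₁`, the far-root term on the top block is the coarse jet `D̄₁`, on the lower blocks it
VANISHES (iterated roots are not residual parameters) — the door's `c1`. -/
theorem compIns₁_mul_tgrad :
    ∀ (n : ℕ) (M : Fin (d + 1) → ℕ) [∀ μ, NeZero (M μ)] (lev : ℕ → ℕ) (rs : ℕ → (Fin (d + 1) → ℕ)) (hrs : ∀ k, rs k ∈ box (d + 1) Lc)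
      (h : ↥(pbox (towerTorus Lc M n)) × Fin (d + 1) → ℝ),
      compIns₁ Lc M lev rs n h
          * (tgrad (towerTorus Lc M n)).submatrix
              (fun b : ↥(pbox (towerTorus Lc M n)) × Fin (d + 1) => ((b.1, Sum.inl b.2) : Idx (towerTorus Lc M n) (Fib d))) id
        = compRows Lc M lev rs n
              * Matrix.of (fun (b : ↥(pbox (towerTorus Lc M n)) × Fin (d + 1)) (s : ↥(pbox (towerTorus Lc M n))) =>
                  h b * tdelta (towerTorus Lc M n) ((b.1 : Site (d + 1)) + unitVec b.2) s)
            - Matrix.of (fun (a : ↥(pbox M) × Fin (d + 1)) (s : ↥(pbox (towerTorus Lc M n))) =>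
                (compRows Lc M lev rs n *ᵥ h) a
                  * tdelta (towerTorus Lc M n) ((itRoot Lc M rs hrs n (wrapPt M ((a.1 : Site (d + 1)) + unitVec a.2)) : ↥(pbox (towerTorus Lc M n))) : Site (d + 1)) s)
  | 0, M, _, lev, rs, hrs, h => by
    show (0 : Matrix (↥(pbox M) × Fin (d + 1)) (↥(pbox M) × Fin (d + 1)) ℝ)
          * (tgrad M).submatrix (fun b : ↥(pbox M) × Fin (d + 1) => ((b.1, Sum.inl b.2) : Idx M (Fib d))) id
        = (1 : Matrix (↥(pbox M) × Fin (d + 1)) (↥(pbox M) × Fin (d + 1)) ℝ)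
              * Matrix.of (fun (b : ↥(pbox M) × Fin (d + 1)) (s : ↥(pbox M)) => h b * tdelta M ((b.1 : Site (d + 1)) + unitVec b.2) s)
            - Matrix.of (fun (a : ↥(pbox M) × Fin (d + 1)) (s : ↥(pbox M)) =>
                ((1 : Matrix (↥(pbox M) × Fin (d + 1)) (↥(pbox M) × Fin (d + 1)) ℝ) *ᵥ h) a
                  * tdelta M ((wrapPt M ((a.1 : Site (d + 1)) + unitVec a.2) : ↥(pbox M)) : Site (d + 1)) s)
    rw [Matrix.zero_mul, Matrix.one_mul, Matrix.one_mulVec, eq_comm, sub_eq_zero]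
    ext a s
    rw [Matrix.of_apply, Matrix.of_apply, tdelta_wrapPt]
  | n + 1, M, _, lev, rs, hrs, h =>
    compIns₁_mul_tgrad_step Lc n M lev rs hrs h (compIns₁_mul_tgrad n (fine Lc M) (fun k => lev (k + 1)) (fun k => rs (k + 1)) (fun k => hrs (k + 1)) h)

end Tower

end Summit.QuantumFields.BalabanUV.Beta.FP.TorusCompositeCovarianceOne

end
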